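import Summits.QuantumFields.YangMills.Theorems.UV3PinnedRestrictedStep
import HarnessLib

/-!
# R3 (cell `ym3-torus`, YM₃ on T³ — a ladder RUNG, NOT d = 4, NOT the Clay problem), UV3-node side of `stub_pinnedStep` (R-19936-S) —
# **THE EXPLICIT PINNED HISTORY FAMILY AND ROW (S-i) AT THE LANE'S OBJECTS**: «`a ∈ P_s(h)` ∨ `a` meets an earlier enlargement (`¬ plaqCover a ⊆ Ω_s(h↾s)`)»
# is closed under the lane's covering above the pin and contains the pin-level covering histories; hence (✓`UV3PinnedRestrictedStep` §3–§4) the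
# restricted (41) for that family at every level above the pin, for the AC tower, modulo the package's residual leaves

Seat `ym3-torus-px8` g11.  THEOREMS ONLY (0 `def`, 0 `sorry`); `--supports stmt-QuantumFields-19936 --as helper`; count-neutral.  Sequel of
✓`UV3PinnedRestrictedStep` (split for the 400-line rule); LOCATE `LOCATE-PINNED41-RESTRICTION-px8g11.md` (19936 evidence #57) §1(b)–(c), §3 (S-i).

WHAT IS PROVED (ns `…Theorems.UV3PinnedRestrictedStep`, continued):
* ★ `snoc_apply_lt` / `snoc_apply_self` / `trunc_snoc` / `trunc_self` — `Hist = (j : Fin k) → Finset (Plaq j)` bookkeeping (`Hist.proj_snoc`/`last_snoc`).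
* ★ `pinFamily_snoc_iff` — closure of the pinned family under `snoc` above the pin; ★ `mem_pinFamily_snoc_of_pin` — the pin-level covering history
  `h ⌢ largeSet(h,U)` is pinned (`εL s ≤ θ ≤ dist1 U(∂a)`; ✓`UV3PinnedTransportStep.mem_largeSet_of_le` + the collar branch).
* ★★★ `pinned41_above_of_residualsAC` — from `σ_s ≤ 𝟙{θ ≤ dist1 U(∂a)}·ρ_s` a.e. (`eps1Of s ≤ θ`), `σ_{k+1} =ᵐ T_k σ_k`, the residual leaves ∕ `hint` ∕ `fibre49`:
  `σ_k ≤ Σ_{h : a ∈ h(s) ∨ ¬ plaqCover a ⊆ Ω_s(h↾s)} m_k(h)·exp[(41)_k exponent]` `dV`-a.e. at every `s + 1 ≤ k ≤ K`.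

HONEST SCOPE.  Bookkeeping; (α)/(β) rows displayed; (S-ii), S-step, `hP`, `HistoryTailL` (19936) NOT proved; nothing continuum ∕ OS ∕ mass-gap ∕ Clay.
References: T. Bałaban, CMP **102** (1985) 255–275 [Balaban1985UV3] ((7)–(8) pp. 257–258, (41) p. 266, (48)–(49) pp. 267–268, Thm 2 p. 272).
-/

set_option autoImplicit false

noncomputable section

namespace Summit.QuantumFields.YangMills.Theorems.UV3PinnedRestrictedStep

open MeasureTheory
open Literature.MathematicalPhysics.QuantumFieldTheory.Balaban1983to89
open Literature.MathematicalPhysics.QuantumFieldTheory.Balaban1983to89.AveragingRT (rnTransport)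
open Literature.MathematicalPhysics.QuantumFieldTheory.Balaban1985CMP102
open Literature.MathematicalPhysics.QuantumFieldTheory.Balaban1985CMP102.Setting
open Summit.QuantumFields.Balaban3D.Carriers
open Summit.QuantumFields.Balaban3D.Proofs.Bound55Masses (largeSet)
open Summit.QuantumFields.Balaban3D.Proofs.MassesAC
open Summit.QuantumFields.Balaban3D.Proofs.TowerAC
open Summit.QuantumFields.Balaban3D.Proofs.SeriesAC
open Summit.QuantumFields.Balaban3D.Proofs.StandardAC
open Summit.QuantumFields.Balaban3D.Proofs.Bound55AC (Fibre49AC)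

variable {L : ℕ} {S : Scales L} {G : Type} [GaugeGroup G] [MeasurableSpace G] [HaarData G] [RegularGaugeGroup G]
  {V : Type} [NormedAddCommGroup V] [NormedSpace ℂ V]
  (X : ExternalInputsAC S G)

/-! ## §5 The explicit pinned family and row (S-i) at the lane's objects -/

section PinFamily

variable {P' : Params} (M₁ : ℕ) (Rcol : ℕ → ℕ)

/-- `snoc` does not touch the levels below the top: `(h ⌢ P_k)(s) = h(s)` for `s < k`. [folklore] -/
theorem snoc_apply_lt {k : ℕ} (h : Hist P' k) (Pk : Finset (Plaq P' k)) (s : ℕ) (hs : s < k) :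
    (Hist.snoc h Pk) ⟨s, Nat.lt_succ_of_lt hs⟩ = h ⟨s, hs⟩ :=
  congrFun (Hist.proj_snoc h Pk) ⟨s, hs⟩

/-- `(h ⌢ P_s)(s) = P_s` (the newborn set IS the top component). [folklore] -/
theorem snoc_apply_self {s : ℕ} (h : Hist P' s) (Ps : Finset (Plaq P' s)) :
    (Hist.snoc h Ps) ⟨s, Nat.lt_succ_self s⟩ = Ps :=
  Hist.last_snoc h Ps

/-- Truncation below the top commutes with `snoc`: `(h ⌢ P_k)↾s = h↾s` for `s ≤ k`. [folklore] -/
theorem trunc_snoc {k : ℕ} (h : Hist P' k) (Pk : Finset (Plaq P' k)) (s : ℕ) (hs : s ≤ k) :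
    (fun j : Fin s => (Hist.snoc h Pk) (Fin.castLE (hs.trans (Nat.le_succ k)) j)) = fun j => h (Fin.castLE hs j) := by
  funext j
  exact congrFun (Hist.proj_snoc h Pk) (Fin.castLE hs j)

/-- Truncation of a level-`s` history at `s` is the history. [folklore] -/
theorem trunc_self {s : ℕ} (h : Hist P' s) : (fun j : Fin s => h (Fin.castLE le_rfl j)) = h := by
  funext j; rfl

open Classical in
/-- ★ **THE PINNED FAMILY IS CLOSED UNDER `snoc` ABOVE THE PIN**: for `s < k`, `h ⌢ P_k` is pinned iff `h` is (the level-`s` component and the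
truncation below `s` are untouched). [folklore] -/
theorem pinFamily_snoc_iff {s k : ℕ} (hsk : s + 1 ≤ k) (a : Plaq P' s) (h : Hist P' k) (Pk : Finset (Plaq P' k)) :
    (a ∈ (Hist.snoc h Pk) ⟨s, Nat.lt_succ_of_lt hsk⟩ ∨
        ¬ plaqCover a ⊆ Omega M₁ Rcol s (fun j : Fin s => (Hist.snoc h Pk) (Fin.castLE ((Nat.le_of_succ_le hsk).trans (Nat.le_succ k)) j)) s) ↔
      (a ∈ h ⟨s, hsk⟩ ∨ ¬ plaqCover a ⊆ Omega M₁ Rcol s (fun j : Fin s => h (Fin.castLE (Nat.le_of_succ_le hsk) j)) s) := by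
  rw [snoc_apply_lt h Pk s hsk, trunc_snoc h Pk s (Nat.le_of_succ_le hsk)]

open Classical in
/-- ★ **THE PIN-LEVEL COVERING HISTORIES ARE PINNED**: for `h : Hist s`, `U` with `εL s ≤ θ ≤ dist1 U(∂a)`, the lane's covering history
`h ⌢ largeSet(h,U)` has `a` in its level-`s` component when `plaqCover a ⊆ Ω_s(h)` (BRICK A §2), and lies in the collar branch otherwise.
[cite: Balaban1985UV3, (7)-(8) pp.257-258] -/
theorem mem_pinFamily_snoc_of_pin {G' : Type} [GaugeGroup G'] (εL : ℕ → ℝ) {s : ℕ} (a : Plaq P' s) (h : Hist P' s)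
    (U : GaugeField P' s G') {θ : ℝ} (hθ : εL s ≤ θ) (ha : θ ≤ dist1 (GaugeField.plaqHol U a)) :
    a ∈ (Hist.snoc h (largeSet M₁ Rcol εL s h U)) ⟨s, Nat.lt_succ_self s⟩ ∨
      ¬ plaqCover a ⊆ Omega M₁ Rcol s
        (fun j : Fin s => (Hist.snoc h (largeSet M₁ Rcol εL s h U)) (Fin.castLE (Nat.le_succ s) j)) s := by
  rw [snoc_apply_self, trunc_snoc h _ s le_rfl, trunc_self]
  by_cases hcov : plaqCover a ⊆ Omega M₁ Rcol s h s
  · exact Or.inl (UV3PinnedTransportStep.mem_largeSet_of_le M₁ Rcol εL s h U a hθ hcov ha)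
  · exact Or.inr hcov

end PinFamily

section PinLane

open Summit.QuantumFields.Balaban3D.Proofs.Inputs
open Summit.QuantumFields.Balaban3D.Proofs.InputsAC
open Summit.QuantumFields.Balaban3D.Proofs.Thm2AC
open Summit.QuantumFields.Balaban3D.Proofs.Bound55Masses (measurable_dev)

variable (𝔎 : LaneConsts L) {X} (𝔖' : ∀ k, StepSeries S G V (nblkOf S 𝔎.carrier k) k)

open Classical in
/-- ★★★ **ROW (S-i) AT THE LANE'S OBJECTS — THE PINNED (41) ABOVE THE PIN FOR THE AC TOWER.**  Window `g²ε₀ ≤ 1`; the residual leaves,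
`hint`, `hfibre` at every step (the (α) package); pinned level `s`, plaquette `a : Plaq s`, threshold `θ ≥ eps1Of s` (the lane's large-field
threshold — the pin is read at the PACKAGE profile, LOCATE (F2)); a sequence `σ_k ≥ 0`, integrable, `σ_{k+1} =ᵐ T_k σ_k` above `s`, with
`σ_s ≤ 𝟙{θ ≤ dist1 U(∂a)}·ρ_s` a.e.  THEN at every `s + 1 ≤ k ≤ K`:
`σ_k ≤ Σ_{h : a ∈ h(s) ∨ ¬ plaqCover a ⊆ Ω_s(h↾s)} m_k(h)·exp[−mainT_k + Pint_k − E_k + Zterm_k + Rm_k]` `dV`-a.e. — histories NOT through the pin and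
NOT already large near `a` at a finer level carry NO mass.  §4 at the pin + §3 above it for the §5 family. [cite: Balaban1985UV3, (7)-(8) pp.257-258 + (41) p.266 + (48)-(49) pp.267-268 + Thm 2 p.272] -/
theorem pinned41_above_of_residualsAC (hw : S.g ^ 2 * S.ε₀ ≤ 1)
    (R : ∀ k, k + 1 ≤ S.K → StepResidualsAC 𝔎 X 𝔖' k)
    (hint : ∀ k, k + 1 ≤ S.K → ∀ h : Hist S.P k, Integrable (fun U => (inputOfAC 𝔎 X 𝔖').W.mass k h U *
      Real.exp (-((towerWAC 𝔎 X 𝔖').mainT k h U) + (inputOfAC 𝔎 X 𝔖').Pint k h U - (towerWAC 𝔎 X 𝔖').Ecst k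
        + (towerWAC 𝔎 X 𝔖').Zterm k h + (towerWAC 𝔎 X 𝔖').Rm k)) (fieldMeasure S.P k G))
    (hfibre : ∀ k, k + 1 ≤ S.K → ∀ h' : Hist S.P (k + 1), Fibre49AC X 𝔎.carrier 𝔖' (fun _ => True) k (piecesWAC 𝔎 X 𝔖' k) h')
    (s : ℕ) (hs : s + 1 ≤ S.K) (a : Plaq S.P s) (θ : ℝ) (hθ : eps1Of S 𝔎.carrier s ≤ θ)
    (σ : (k : ℕ) → Density S.P k G) (hσ0 : ∀ k U, 0 ≤ σ k U) (hσi : ∀ k, Integrable (σ k) (fieldMeasure S.P k G))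
    (hσT : ∀ k, s ≤ k → k + 1 ≤ S.K → σ (k + 1) =ᵐ[fieldMeasure S.P (k + 1) G] rnTransport (X.av k).avg (σ k))
    (hσs : σ s ≤ᵐ[fieldMeasure S.P s G] fun U =>
      {U : GaugeField S.P s G | θ ≤ dist1 (GaugeField.plaqHol U a)}.indicator (fun _ => (1 : ℝ)) U * (towerOfAC 𝔎 X 𝔖').ρ s U) :
    ∀ (k : ℕ) (hsk : s + 1 ≤ k), k ≤ S.K → σ k ≤ᵐ[fieldMeasure S.P k G] fun W =>
      ∑ h ∈ Finset.univ.filter (fun h : Hist S.P k =>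
          a ∈ h ⟨s, hsk⟩ ∨ ¬ plaqCover a ⊆ Omega 𝔎.carrier.M₁ (rcolOf S 𝔎.carrier) s
            (fun j : Fin s => h (Fin.castLE (Nat.le_of_succ_le hsk) j)) s),
        (inputOfAC 𝔎 X 𝔖').W.mass k h W *
          Real.exp (-((towerOfAC 𝔎 X 𝔖').mainT k h W) + (towerOfAC 𝔎 X 𝔖').Pint k h W
            - (towerOfAC 𝔎 X 𝔖').Ecst k + (towerOfAC 𝔎 X 𝔖').Zterm k h + (towerOfAC 𝔎 X 𝔖').Rm k) := by
  -- the family at all levels (junk below the pin: never read)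
  let Ha : (k : ℕ) → Finset (Hist S.P k) := fun k =>
    if hsk : s + 1 ≤ k then
      Finset.univ.filter (fun h : Hist S.P k =>
        a ∈ h ⟨s, hsk⟩ ∨ ¬ plaqCover a ⊆ Omega 𝔎.carrier.M₁ (rcolOf S 𝔎.carrier) s
          (fun j : Fin s => h (Fin.castLE (Nat.le_of_succ_le hsk) j)) s)
    else ∅
  have hHa_eq : ∀ (k : ℕ) (hsk : s + 1 ≤ k), Ha k = Finset.univ.filter (fun h : Hist S.P k =>
        a ∈ h ⟨s, hsk⟩ ∨ ¬ plaqCover a ⊆ Omega 𝔎.carrier.M₁ (rcolOf S 𝔎.carrier) s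
          (fun j : Fin s => h (Fin.castLE (Nat.le_of_succ_le hsk) j)) s) := fun k hsk => by
    simp only [Ha, dif_pos hsk]
  -- closure under the lane's covering above the pin
  have hHa : ∀ k, s + 1 ≤ k → k + 1 ≤ S.K → ∀ h ∈ Ha k, ∀ U : GaugeField S.P k G, (inputOfAC 𝔎 X 𝔖').W.mass k h U ≠ 0 →
      Hist.snoc h (largeSet 𝔎.carrier.M₁ (rcolOf S 𝔎.carrier) (eps1Of S 𝔎.carrier) k h U) ∈ Ha (k + 1) := by
    intro k hsk _ h hh U _
    rw [hHa_eq k hsk, Finset.mem_filter] at hh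
    rw [hHa_eq (k + 1) (by omega), Finset.mem_filter]
    exact ⟨Finset.mem_univ _, (pinFamily_snoc_iff 𝔎.carrier.M₁ (rcolOf S 𝔎.carrier) hsk a h _).mpr hh.2⟩
  -- the pin level
  have hA : MeasurableSet {U : GaugeField S.P s G | θ ≤ dist1 (GaugeField.plaqHol U a)} :=
    measurableSet_le measurable_const (measurable_dev a)
  have hbase : σ (s + 1) ≤ᵐ[fieldMeasure S.P (s + 1) G] fun W => ∑ h ∈ Ha (s + 1), (inputOfAC 𝔎 X 𝔖').W.mass (s + 1) h W *
      Real.exp (-((towerOfAC 𝔎 X 𝔖').mainT (s + 1) h W) + (towerOfAC 𝔎 X 𝔖').Pint (s + 1) h W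
        - (towerOfAC 𝔎 X 𝔖').Ecst (s + 1) + (towerOfAC 𝔎 X 𝔖').Zterm (s + 1) h + (towerOfAC 𝔎 X 𝔖').Rm (s + 1)) := by
    have hpin := restricted41_succ_of_pin 𝔎 𝔖' s hs hw R (hint s hs) (hfibre s hs)
      {U : GaugeField S.P s G | θ ≤ dist1 (GaugeField.plaqHol U a)} hA (Ha (s + 1))
      (fun h U hU hm => by
        rw [hHa_eq (s + 1) le_rfl, Finset.mem_filter]
        exact ⟨Finset.mem_univ _, mem_pinFamily_snoc_of_pin 𝔎.carrier.M₁ (rcolOf S 𝔎.carrier) (eps1Of S 𝔎.carrier) a h U hθ hU⟩)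
      (σ s) (hσ0 s) (hσi s) hσs
    filter_upwards [hσT s le_rfl hs, hpin] with W hW hp
    rw [hW]
    exact hp
  -- the induction above
  intro k hsk hkK
  have hmain := restricted41_above_of_residualsAC 𝔎 𝔖' hw R hint hfibre (s + 1) Ha
    (fun k hk hk1 => hHa k hk hk1) σ hσ0 hσi (fun k hk hk1 => hσT k (by omega) hk1) hbase k hsk hkK
  rw [hHa_eq k hsk] at hmain
  exact hmain

end PinLane

end Summit.QuantumFields.YangMills.Theorems.UV3PinnedRestrictedStep

end
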